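import Summits.BirchSwinnertonDyer.BirchSwinnertonDyer.Theses.ShaPrimaryTransfer
import Summits.BirchSwinnertonDyer.BirchSwinnertonDyer.Theses.SelmerRank
import Literature.NumberTheory.EllipticCurves.Zywina2025Torsion
import Literature.NumberTheory.EllipticCurves.SupersingularDensityProofs

/-!
# BirchSwinnertonDyer / ShaPrimaryTransfer — crux `FiniteShaComponentTransfer` (stmt-BirchSwinnertonDyer-22356):
# the ORDINARY-PAIR slice is finiteness-free and downstream of Selmer-rank BSD (route SelmerRank's cruxes)

The route header (TWO-LAYER PLAN) splits T = `FiniteShaComponentTransfer` («`t_p(E) = 0 ⟹ t_q(E) = 0`»,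
`t_p(E) = corank_{ℤ_p} Ш(E)[p^∞]`) into `TransferRankLeOne` (Gross–Zagier–Kolyvagin; `…Slices` §4),
`TransferOrdinaryPair` («`p, q` both good ordinary `≥ 5`: the Iwasawa-theoretic slice … through the common
interpolated values `L(E,χ,1)`») and `TransferToSmallPrime`, and models T on the function-field theorem where the
`L`-function is the `p`-independent intermediary. This helper file (prover seat `bsd-line-spt-p1` g2,
`--supports stmt-22356 --as helper`) makes the number-field version of that mechanism precise and shows where
it already lives in the tree:

* §1 SELMER-RANK BSD AT GOOD ORDINARY PRIMES («SRB»: `corank_{ℤ_p} Sel_{p^∞}(E/ℚ) = ord_{s=1} L(E,s)` at every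
  good ordinary `p ≥ 5`, on global minimal models) is EXACTLY the conjunction of route SelmerRank's cruxes
  `SelmerRankUB` (stmt-0130), `SelmerRankLB` (stmt-0131) and support `SelmerRankSmallImage` (stmt-14418)
  (`selmerCorank_eq_analyticRank_of_SRB`; case split on the image of `ρ̄_{E,p}`).
* §2 GRANTING SRB, `t_p(E)` IS `p`-INDEPENDENT ON GOOD ORDINARY PRIMES `≥ 5` WITHOUT ANY FINITENESS:
  `t_p(E) = ord_{s=1} L(E,s) − rank E(ℚ)` there (`shaCorank_eq_analyticRank_sub_rank_of_SRB`, Greenberg's identity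
  `corank Sel_{p^∞} = rank + t_p`, tree theorem), hence `t_p(E) = t_q(E)` (`shaCorank_eq_of_SRB`) and the
  ORDINARY-PAIR SLICE OF T HOLDS (`transferOrdinaryPair_of_SRB`) — also when `Ш` is infinite (then uniformly so).
  So `TransferOrdinaryPair` needs no item beyond 0130/0131/14418, and its «common interpolated values» are just
  `ord_{s=1} L(E,s)`; `rank E(ℚ) ≤ ord_{s=1} L(E,s)` for every `E/ℚ` is a by-product (`rank_le_analyticRank_of_SRB`).
* §3 GRANTING SRB, THE REST OF T IS RANK-BSD FOR DOORED CURVES: at a good ordinary `q ≥ 5`,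
  `t_q(E) = 0 ⟺ ord_{s=1} L(E,s) = rank E(ℚ)` (`shaCorank_eq_zero_iff_rankBSD_of_SRB`), so the weak transfer the
  assembly uses («door at ANY `p₀` ⟹ `t_q = 0` at good ordinary `q ≥ 5`», `…AssemblyWeakTransfer`) is, under SRB,
  literally «a curve with ONE finite `Ш`-component satisfies rank-BSD» (`weakTransfer_iff_door_rankBSD_of_SRB`).
  Numbers, not adjectives: under SRB the transfer from the door at `2` carries the whole rank statement.
* §4 On Zywina's kernel-certified rank-2 family (`rank E_{m,n}(ℚ) = 2`, `t_2(E_{m,n}) = 0` PROVED, companion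
  `…RankTwoDoor`): granting SRB, `t_q(E_{m,n}) = ord_{s=1} L(E_{m,n},s) − 2` at every good ordinary `q ≥ 5`, so T's
  instance there is `ord_{s=1} L(E_{m,n},s) = 2` (`shaCorank_zywinaCurve_eq_zero_iff_of_SRB`).

Everything is CONDITIONAL on the named route items (all open); nothing here proves T, SRB or BSD.

References: R. Greenberg, LNM 1716 (1999), §1 pp. 54–57 (corank identity); D. Ulmer, in *Arithmetic Geometry
over Global Function Fields* (Birkhäuser 2014), §7.1 p. 317 (the function-field sibling: Tate / Milne /
Kato–Trihan); D. Zywina, arXiv:2502.01957 (2025), Thm. 1.2; J.-P. Serre, Publ. Math. IHÉS 54 (1981), §8.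
-/

-- D-0017: single-problem summit, so `Summit.BirchSwinnertonDyer.BirchSwinnertonDyer.…` repeats a namespace BY DESIGN.
set_option linter.dupNamespace false

noncomputable section

namespace Summit.BirchSwinnertonDyer.BirchSwinnertonDyer.Theorems.ShaPrimaryTransferOrdinaryPair

open scoped Classical
open Literature.NumberTheory.EllipticCurves Literature.NumberTheory.EllipticCurves.Zywina2025
open WeierstrassCurve
open Summit.BirchSwinnertonDyer.BirchSwinnertonDyer.Theses.ShaPrimaryTransfer (FiniteShaComponentTransfer)
open Summit.BirchSwinnertonDyer.BirchSwinnertonDyer.Theses.SelmerRank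
  (SelmerRankUB SelmerRankLB SelmerRankSmallImage)

/-! ## §1 Selmer-rank BSD at good ordinary primes = UB ∧ LB ∧ SmallImage -/

/-- **Selmer-rank BSD at a good ordinary prime `p ≥ 5`** from route SelmerRank's items: `SelmerRankUB` and
`SelmerRankLB` when `ρ̄_{E,p}` is surjective, `SelmerRankSmallImage` when it is not. CONDITIONAL on the three
items (stmt-0130, 0131, 14418). [folklore] -/
theorem selmerCorank_eq_analyticRank_of_SRB (hUB : SelmerRankUB) (hLB : SelmerRankLB)
    (hSI : SelmerRankSmallImage) (W : WeierstrassCurve ℚ) [W.IsElliptic] [W.IsGloballyMinimal] (p : ℕ)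
    [Fact p.Prime] (h5 : 5 ≤ p) (hgood : W.HasGoodReductionAtPrime p) (hord : ¬ (p : ℤ) ∣ W.frobeniusTrace p) :
    W.selmerCorank p = W.analyticRank := by
  by_cases hs : W.HasSurjectiveModNGaloisRep p
  · exact le_antisymm (hUB W p h5 hgood hord hs) (hLB W p h5 hgood hord hs)
  · exact hSI W p h5 hgood hord hs

/-- Conversely the three items follow from Selmer-rank BSD at every good ordinary `p ≥ 5`: SRB is EXACTLY
`UB ∧ LB ∧ SmallImage`. [folklore] -/
theorem SRB_iff :
    (∀ (W : WeierstrassCurve ℚ) [W.IsElliptic] [W.IsGloballyMinimal] (p : ℕ) [Fact p.Prime], 5 ≤ p →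
        W.HasGoodReductionAtPrime p → ¬ (p : ℤ) ∣ W.frobeniusTrace p → W.selmerCorank p = W.analyticRank) ↔
      (SelmerRankUB ∧ SelmerRankLB ∧ SelmerRankSmallImage) := by
  constructor
  · intro h
    exact ⟨fun W _ _ p _ h5 hg ho _ => (h W p h5 hg ho).le, fun W _ _ p _ h5 hg ho _ => (h W p h5 hg ho).ge,
      fun W _ _ p _ h5 hg ho _ => h W p h5 hg ho⟩
  · rintro ⟨hUB, hLB, hSI⟩ W _ _ p _ h5 hg ho
    exact selmerCorank_eq_analyticRank_of_SRB hUB hLB hSI W p h5 hg ho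

/-! ## §2 Granting SRB: `t_p = ord L − rank` on good ordinary primes, hence the ordinary-pair slice of T -/

/-- **`t_p(E) = ord_{s=1} L(E,s) − rank E(ℚ)` at every good ordinary `p ≥ 5`, granting SRB** (and
`rank ≤ ord`): Greenberg's identity `corank Sel_{p^∞} = rank + t_p` (tree theorem
`selmerCorank_eq_mordellWeilRank_add_holds`) with `corank Sel_{p^∞} = ord`. No finiteness of any `Ш`-component
is used or produced. CONDITIONAL on `hUB`, `hLB`, `hSI`. [cite: Greenberg1999LNM, §1 pp. 54–57] -/
theorem shaCorank_eq_analyticRank_sub_rank_of_SRB (hUB : SelmerRankUB) (hLB : SelmerRankLB)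
    (hSI : SelmerRankSmallImage) (W : WeierstrassCurve ℚ) [W.IsElliptic] [W.IsGloballyMinimal] (p : ℕ)
    [Fact p.Prime] (h5 : 5 ≤ p) (hgood : W.HasGoodReductionAtPrime p) (hord : ¬ (p : ℤ) ∣ W.frobeniusTrace p) :
    W.mordellWeilRank ≤ W.analyticRank ∧ W.shaCorank p = W.analyticRank - W.mordellWeilRank := by
  have h1 := selmerCorank_eq_analyticRank_of_SRB hUB hLB hSI W p h5 hgood hord
  have h2 : W.selmerCorank p = W.mordellWeilRank + W.shaCorank p := W.selmerCorank_eq_mordellWeilRank_add_holds p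
  omega

/-- **`rank E(ℚ) ≤ ord_{s=1} L(E,s)` for every elliptic `E/ℚ` on a global minimal model, granting SRB** — through
ANY good ordinary prime `p ≥ 5` (one exists: tree theorem `infinite_goodOrdinaryPrimes_holds`, Serre 1981 §8).
CONDITIONAL on `hUB`, `hLB`, `hSI`. [cite: Serre1981, §8 Cor. 2] -/
theorem rank_le_analyticRank_of_SRB (hUB : SelmerRankUB) (hLB : SelmerRankLB) (hSI : SelmerRankSmallImage)
    (W : WeierstrassCurve ℚ) [W.IsElliptic] [W.IsGloballyMinimal] : W.mordellWeilRank ≤ W.analyticRank := by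
  obtain ⟨p, hp, h5, hgood, hord⟩ := exists_good_ordinary_prime_of_infinite infinite_goodOrdinaryPrimes_holds W
  exact (shaCorank_eq_analyticRank_sub_rank_of_SRB hUB hLB hSI W p h5 hgood hord).1

/-- **Uniformity on ordinary pairs, granting SRB**: `t_p(E) = t_q(E)` for any two good ordinary primes
`p, q ≥ 5` — the `p`-independence of `corank_{ℤ_p} Ш(E)[p^∞]` on that set of primes, with `ord_{s=1} L(E,s)` as
the `p`-free intermediary (the number-field shadow of Tate–Milne–Kato–Trihan). Finiteness-free.
CONDITIONAL on `hUB`, `hLB`, `hSI`. [cite: Greenberg1999LNM, §1 pp. 54–57] -/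
theorem shaCorank_eq_of_SRB (hUB : SelmerRankUB) (hLB : SelmerRankLB) (hSI : SelmerRankSmallImage)
    (W : WeierstrassCurve ℚ) [W.IsElliptic] [W.IsGloballyMinimal] (p q : ℕ) [Fact p.Prime] [Fact q.Prime]
    (hp5 : 5 ≤ p) (hpg : W.HasGoodReductionAtPrime p) (hpo : ¬ (p : ℤ) ∣ W.frobeniusTrace p)
    (hq5 : 5 ≤ q) (hqg : W.HasGoodReductionAtPrime q) (hqo : ¬ (q : ℤ) ∣ W.frobeniusTrace q) :
    W.shaCorank p = W.shaCorank q := by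
  rw [(shaCorank_eq_analyticRank_sub_rank_of_SRB hUB hLB hSI W p hp5 hpg hpo).2,
    (shaCorank_eq_analyticRank_sub_rank_of_SRB hUB hLB hSI W q hq5 hqg hqo).2]

/-- **The ordinary-pair slice of T, granting SRB** (the route header's `TransferOrdinaryPair`): for `E/ℚ` on a
global minimal model and good ordinary primes `p, q ≥ 5`, `t_p(E) = 0 ⟹ t_q(E) = 0`. Downstream of route
SelmerRank's items 0130/0131/14418 alone — NOT of `SelmerRankShaPFinite` (0132). CONDITIONAL on `hUB`, `hLB`,
`hSI`. [cite: Greenberg1999LNM, §1 pp. 54–57] -/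
theorem transferOrdinaryPair_of_SRB (hUB : SelmerRankUB) (hLB : SelmerRankLB) (hSI : SelmerRankSmallImage) :
    ∀ (W : WeierstrassCurve ℚ) [W.IsElliptic] [W.IsGloballyMinimal] (p q : ℕ) [Fact p.Prime] [Fact q.Prime],
      5 ≤ p → W.HasGoodReductionAtPrime p → ¬ (p : ℤ) ∣ W.frobeniusTrace p →
      5 ≤ q → W.HasGoodReductionAtPrime q → ¬ (q : ℤ) ∣ W.frobeniusTrace q →
      W.shaCorank p = 0 → W.shaCorank q = 0 := by
  intro W _ _ p q _ _ hp5 hpg hpo hq5 hqg hqo h0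
  rw [← shaCorank_eq_of_SRB hUB hLB hSI W p q hp5 hpg hpo hq5 hqg hqo]
  exact h0

/-! ## §3 Granting SRB, the rest of T is rank-BSD for doored curves -/

/-- **`t_q(E) = 0 ⟺ ord_{s=1} L(E,s) = rank E(ℚ)` at a good ordinary `q ≥ 5`, granting SRB.** So a door at ANY
prime `p₀` transfers to `q` exactly when `E` satisfies rank-BSD. CONDITIONAL on `hUB`, `hLB`, `hSI`.
[cite: Greenberg1999LNM, §1 pp. 54–57] -/
theorem shaCorank_eq_zero_iff_rankBSD_of_SRB (hUB : SelmerRankUB) (hLB : SelmerRankLB)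
    (hSI : SelmerRankSmallImage) (W : WeierstrassCurve ℚ) [W.IsElliptic] [W.IsGloballyMinimal] (q : ℕ)
    [Fact q.Prime] (h5 : 5 ≤ q) (hgood : W.HasGoodReductionAtPrime q) (hord : ¬ (q : ℤ) ∣ W.frobeniusTrace q) :
    W.shaCorank q = 0 ↔ W.analyticRank = W.mordellWeilRank := by
  have h := shaCorank_eq_analyticRank_sub_rank_of_SRB hUB hLB hSI W q h5 hgood hord
  omega

/-- **Granting SRB, the weak transfer used by the assembly IS «one finite `Ш`-component ⟹ rank-BSD».** The
left side is the hypothesis `hTw` of `ShaPrimaryTransferWeakTransfer.bsd_of_weakTransfer` (door at any `p₀` ⟹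
`t_q = 0` at every good ordinary `q ≥ 5`, global minimal models); the right side says: every elliptic `E/ℚ` on a
global minimal model having SOME prime `p₀` with `corank_{ℤ_{p₀}} Ш(E)[p₀^∞] = 0` has `ord_{s=1} L(E,s) = rank E(ℚ)`.
CONDITIONAL on `hUB`, `hLB`, `hSI`. [cite: Greenberg1999LNM, §1 pp. 54–57] [cite: Serre1981, §8 Cor. 2] -/
theorem weakTransfer_iff_door_rankBSD_of_SRB (hUB : SelmerRankUB) (hLB : SelmerRankLB)
    (hSI : SelmerRankSmallImage) :
    (∀ (W : WeierstrassCurve ℚ) [W.IsElliptic] [W.IsGloballyMinimal] (p₀ q : ℕ) [Fact p₀.Prime] [Fact q.Prime],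
        5 ≤ q → W.HasGoodReductionAtPrime q → ¬ (q : ℤ) ∣ W.frobeniusTrace q →
        W.shaCorank p₀ = 0 → W.shaCorank q = 0) ↔
      ∀ (W : WeierstrassCurve ℚ) [W.IsElliptic] [W.IsGloballyMinimal],
        (∃ (p₀ : ℕ) (_ : Fact p₀.Prime), W.shaCorank p₀ = 0) → W.analyticRank = W.mordellWeilRank := by
  constructor
  · intro hTw W _ _ hdoor
    obtain ⟨p₀, hp₀, h0⟩ := hdoor
    obtain ⟨q, hq, h5, hgood, hord⟩ :=
      exists_good_ordinary_prime_of_infinite infinite_goodOrdinaryPrimes_holds W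
    exact (shaCorank_eq_zero_iff_rankBSD_of_SRB hUB hLB hSI W q h5 hgood hord).1
      (hTw W p₀ q h5 hgood hord h0)
  · intro hBSD W _ _ p₀ q _ _ h5 hgood hord h0
    exact (shaCorank_eq_zero_iff_rankBSD_of_SRB hUB hLB hSI W q h5 hgood hord).2 (hBSD W ⟨p₀, ‹_›, h0⟩)

/-- In particular, **granting SRB, T implies rank-BSD for every curve with one finite `Ш`-component** (on a
global minimal model). CONDITIONAL on `hT`, `hUB`, `hLB`, `hSI`. [cite: Greenberg1999LNM, §1 pp. 54–57] -/
theorem rankBSD_of_door_of_transfer_of_SRB (hT : FiniteShaComponentTransfer) (hUB : SelmerRankUB)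
    (hLB : SelmerRankLB) (hSI : SelmerRankSmallImage) (W : WeierstrassCurve ℚ) [W.IsElliptic]
    [W.IsGloballyMinimal] (p₀ : ℕ) [Fact p₀.Prime] (h0 : W.shaCorank p₀ = 0) :
    W.analyticRank = W.mordellWeilRank :=
  (weakTransfer_iff_door_rankBSD_of_SRB hUB hLB hSI).1 (fun W _ _ p₀ q _ _ _ _ _ h => hT W p₀ q h) W
    ⟨p₀, ‹_›, h0⟩

/-! ## §4 On Zywina's rank-2 family -/

/-- **On `E_{m,n}`, granting SRB: `t_q(E_{m,n}) = ord_{s=1} L(E_{m,n},s) − 2`** at every good ordinary `q ≥ 5`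
(`rank = 2` is Zywina's theorem), and `2 ≤ ord`. CONDITIONAL on `hUB`, `hLB`, `hSI`. [cite: Zywina2025, Thm 1.2]
[cite: Greenberg1999LNM, §1 pp. 54–57] -/
theorem shaCorank_zywinaCurve_eq_of_SRB (hUB : SelmerRankUB) (hLB : SelmerRankLB) (hSI : SelmerRankSmallImage)
    {m n : ℕ} (h : ZywinaAdmissible m n) (q : ℕ) [Fact q.Prime] [(zywinaCurve m n).IsElliptic]
    [(zywinaCurve m n).IsGloballyMinimal] (h5 : 5 ≤ q) (hgood : (zywinaCurve m n).HasGoodReductionAtPrime q)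
    (hord : ¬ (q : ℤ) ∣ (zywinaCurve m n).frobeniusTrace q) :
    2 ≤ (zywinaCurve m n).analyticRank ∧
      (zywinaCurve m n).shaCorank q = (zywinaCurve m n).analyticRank - 2 := by
  have := shaCorank_eq_analyticRank_sub_rank_of_SRB hUB hLB hSI (zywinaCurve m n) q h5 hgood hord
  rwa [mordellWeilRank_zywinaCurve h] at this

/-- **T's instance at `(E_{m,n}, 2, q)`, `q ≥ 5` good ordinary, IS `ord_{s=1} L(E_{m,n},s) = 2` granting SRB**
(the door `t_2(E_{m,n}) = 0` being a theorem). CONDITIONAL on `hUB`, `hLB`, `hSI`. [cite: Zywina2025, Thm 1.2] -/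
theorem shaCorank_zywinaCurve_eq_zero_iff_of_SRB (hUB : SelmerRankUB) (hLB : SelmerRankLB)
    (hSI : SelmerRankSmallImage) {m n : ℕ} (h : ZywinaAdmissible m n) (q : ℕ) [Fact q.Prime]
    [(zywinaCurve m n).IsElliptic] [(zywinaCurve m n).IsGloballyMinimal] (h5 : 5 ≤ q)
    (hgood : (zywinaCurve m n).HasGoodReductionAtPrime q) (hord : ¬ (q : ℤ) ∣ (zywinaCurve m n).frobeniusTrace q) :
    (zywinaCurve m n).shaCorank q = 0 ↔ (zywinaCurve m n).analyticRank = 2 := by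
  rw [shaCorank_eq_zero_iff_rankBSD_of_SRB hUB hLB hSI (zywinaCurve m n) q h5 hgood hord,
    mordellWeilRank_zywinaCurve h]

end Summit.BirchSwinnertonDyer.BirchSwinnertonDyer.Theorems.ShaPrimaryTransferOrdinaryPair
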